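import Literature.NumberTheory.LFunctions.PsiThetaSmallRun1
import Literature.NumberTheory.LFunctions.PsiThetaSmallRun2
import Literature.NumberTheory.LFunctions.PsiThetaSmallRun3
import Literature.NumberTheory.LFunctions.PsiThetaSmallRun4
import Literature.NumberTheory.LFunctions.PsiThetaSmallRun5
import Literature.NumberTheory.LFunctions.PsiThetaSmallRun6
import Literature.NumberTheory.LFunctions.PsiThetaSmallRun7
import Literature.NumberTheory.LFunctions.PsiThetaSmallRun8
import Literature.NumberTheory.LFunctions.Nicolas2012Sharp
import HarnessLib

/-!
# `ψ(x) − θ(x) ≤ √x + (4/3) x^{1/3}` for `1 ≤ x < 2³²`, proved; Nicolas's (2.18) and the two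
# criteria without the named computation `Nicolas2012_lemma24_case1`

Topic: `Literature/NumberTheory/LFunctions` (provefact `Literature.NumberTheory.LFunctions.lagarias_iff`,
plan N4′). Pure proof file (nothing asserted). It assembles the eight kernel-certified chunks
`PsiThetaSmall.run1`–`run8` (`PsiThetaSmallRun*.lean`) through `PsiThetaSmall.runFrom_sound` and
`PsiThetaSmall.psi_sub_theta_le_of_cert` (`PsiThetaSmallCheck.lean`) into

* `psi_sub_theta_le_of_lt_two_pow_32` — **for real `1 ≤ x < 2³²`, `ψ(x) − θ(x) ≤ √x + (4/3) x^{1/3}`**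
  (Nicolas 2012, Lemma 2.4 (2.12), Case 1, with the constant `4/3` that (2.18) consumes in place of
  the printed `1.332768…`; a THEOREM of the tree, whereas the printed Case-1 computation stays
  recorded as the named fact `Literature.NumberTheory.LFunctions.Nicolas2012_lemma24_case1`);
* `Nicolas2012_lemma24_upper_of (hRH) (hS) (hPT)` — (2.12) for all `x ≥ 1` from Schoenfeld's
  `θ`-bound and Platt–Trudgian only (Cases 2–3 are `NicolasPsiTheta.psi_sub_theta_le_case2/3`);
* `Nicolas2012_logf_lower_sharp_of_lemma24 (hS) (h24)` — (2.18) from Schoenfeld's bound and any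
  proof of (2.12) under RH (the argument of `Nicolas2012Sharp.Nicolas2012_logf_lower_sharp_of`), whence
  `Nicolas2012_logf_lower_sharp_of' (hS) (hPT)` and the criteria
  `lagarias_iff_of_schoenfeld_plattTrudgian (hS) (hPT) (hnum : RH → robinCA_below (4^11))`,
  `lagarias_iff_of_schoenfeld_plattTrudgian_briggs (hS) (hPT) (hB)`,
  `robin_iff_of_schoenfeld_plattTrudgian (hS) (hPT) (hnum)`: Lagarias's Thm. 1.1 and Robin's
  criterion now rest on Schoenfeld 1976 (6.3), Platt–Trudgian's `θ(x) < x` (`x ≤ 1.39·10¹⁷`) and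
  Robin's inequality along the colossally abundant chain below `4¹¹` (or Briggs's table) — one named
  computation fewer than `Nicolas2012Sharp.lean`.

## References

* J.-L. Nicolas, *Small values of the Euler function and the Riemann hypothesis*, Acta Arith. 155
  (2012), 311–321 (arXiv:1202.0729), Lemma 2.4 (2.12) and its proof (Cases 1–3), (2.18). [Nicolas2012]
* L. Schoenfeld, Math. Comp. 30 (1976), 337–360, §6 (6.3). [Schoenfeld1976]
* D. J. Platt, T. S. Trudgian, Math. Comp. 85 (2016), 1539–1547, Thm. 1. [PlattTrudgian2016Theta]
* J. C. Lagarias, Amer. Math. Monthly 109 (2002), 534–543, Thm. 1.1. [Lagarias2002]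
* G. Robin, J. Math. Pures Appl. 63 (1984), 187–213, Thm. 1 and §4 Prop. 1. [Robin1984]
-/

noncomputable section

open Filter Set
open scoped Real Chebyshev

namespace Literature.NumberTheory.LFunctions

namespace PsiThetaSmall

/-- Every `1 ≤ n < 2³²` is certified by one of the eight chunks. [cite: Nicolas2012, Lemma 2.4, proof, Case 1] -/
theorem cert_of_lt {n : ℕ} (hn1 : 1 ≤ n) (hn : n < 2 ^ 32) : Cert table ks30 n := by
  have hT := table_pairwise
  rcases lt_or_ge n 67108864 with h1 | h1
  · exact runFrom_sound hT run1 n hn1 h1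
  rcases lt_or_ge n 268435456 with h2 | h2
  · exact runFrom_sound hT run2 n h1 h2
  rcases lt_or_ge n 603979776 with h3 | h3
  · exact runFrom_sound hT run3 n h2 h3
  rcases lt_or_ge n 1073741824 with h4 | h4
  · exact runFrom_sound hT run4 n h3 h4
  rcases lt_or_ge n 1677721600 with h5 | h5
  · exact runFrom_sound hT run5 n h4 h5
  rcases lt_or_ge n 2415919104 with h6 | h6
  · exact runFrom_sound hT run6 n h5 h6
  rcases lt_or_ge n 3288334336 with h7 | h7
  · exact runFrom_sound hT run7 n h6 h7
  · exact runFrom_sound hT run8 n h7 (by norm_num at hn; omega)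

/-- **`ψ(n) − θ(n) ≤ √n + (4/3) n^{1/3}` for the integers `1 ≤ n < 2³²`.**
[cite: Nicolas2012, Lemma 2.4 (2.12), proof, Case 1] -/
theorem psi_sub_theta_le_nat {n : ℕ} (hn1 : 1 ≤ n) (hn : n < 2 ^ 32) :
    ψ (n : ℝ) - θ (n : ℝ) ≤ Real.sqrt n + 4 / 3 * (n : ℝ) ^ ((1 : ℝ) / 3) := by
  rcases eq_or_lt_of_le hn1 with rfl | hn2
  · rw [Nat.cast_one, Chebyshev.psi_one, Chebyshev.theta_one]
    norm_num
  · exact psi_sub_theta_le_of_cert table_pairwise table_one_le table_complete hn2 hn (cert_of_lt hn1 hn)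

end PsiThetaSmall

/-- **Nicolas 2012, Lemma 2.4 (2.12), Case 1, proved: `ψ(x) − θ(x) ≤ √x + (4/3) x^{1/3}` for real
`1 ≤ x < 2³²`** (a kernel computation over the perfect powers below `2³²`; the printed computation,
with the sharper constant `1.332768…`, is the named fact
`Literature.NumberTheory.LFunctions.Nicolas2012_lemma24_case1`). [cite: Nicolas2012, Lemma 2.4 (2.12), proof, Case 1] -/
theorem psi_sub_theta_le_of_lt_two_pow_32 {x : ℝ} (hx : 1 ≤ x) (hx32 : x < (2 : ℝ) ^ 32) :
    ψ x - θ x ≤ Real.sqrt x + 4 / 3 * x ^ ((1 : ℝ) / 3) := by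
  have hx0 : 0 ≤ x := by linarith
  set n := ⌊x⌋₊ with hn
  have hn1 : 1 ≤ n := Nat.le_floor (by simpa using hx)
  have hnx : (n : ℝ) ≤ x := Nat.floor_le hx0
  have hn32 : n < 2 ^ 32 := by
    have : (n : ℝ) < (2 : ℝ) ^ 32 := hnx.trans_lt hx32
    exact_mod_cast this
  rw [Chebyshev.psi_eq_psi_coe_floor, Chebyshev.theta_eq_theta_coe_floor]
  calc ψ (n : ℝ) - θ (n : ℝ) ≤ Real.sqrt n + 4 / 3 * (n : ℝ) ^ ((1 : ℝ) / 3) :=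
        PsiThetaSmall.psi_sub_theta_le_nat hn1 hn32
    _ ≤ Real.sqrt x + 4 / 3 * x ^ ((1 : ℝ) / 3) := by
        have h1 := Real.sqrt_le_sqrt hnx
        have h2 : (n : ℝ) ^ ((1 : ℝ) / 3) ≤ x ^ ((1 : ℝ) / 3) :=
          Real.rpow_le_rpow (Nat.cast_nonneg n) hnx (by norm_num)
        linarith

/-- **Nicolas 2012, Lemma 2.4, (2.12) for all `x ≥ 1`, without the Case-1 named computation**: under
RH, from Schoenfeld's `θ`-bound and Platt–Trudgian's `θ(y) < y` (Cases 2–3: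
`NicolasPsiTheta.psi_sub_theta_le_case2`, `psi_sub_theta_le_case3`; Case 1:
`psi_sub_theta_le_of_lt_two_pow_32`). [cite: Nicolas2012, Lemma 2.4 (2.12)] -/
theorem Nicolas2012_lemma24_upper_of (hRH : RiemannHypothesis) (hS : Schoenfeld1976_theta)
    (hPT : PlattTrudgian2016_theta_lt) {x : ℝ} (hx : 1 ≤ x) :
    ψ x - θ x ≤ Real.sqrt x + 4 / 3 * x ^ ((1 : ℝ) / 3) := by
  rcases lt_or_ge x ((2 : ℝ) ^ 32) with h32 | h32
  · exact psi_sub_theta_le_of_lt_two_pow_32 hx h32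
  rcases le_or_gt x ((2 : ℝ) ^ 100) with h100 | h100
  · exact NicolasPsiTheta.psi_sub_theta_le_case2 hPT h32 h100
  · exact NicolasPsiTheta.psi_sub_theta_le_case3 hRH hS h100.le

/-- **Nicolas 2012, (2.18) from Schoenfeld's `θ`-bound and any proof of (2.12) under RH** (the
argument of `Nicolas2012Sharp.Nicolas2012_logf_lower_sharp_of`, with Lemma 2.4 abstracted).
[cite: Nicolas2012, (2.18) (proof of Prop. 2.1)] -/
theorem Nicolas2012_logf_lower_sharp_of_lemma24 (hS : Schoenfeld1976_theta)
    (h24 : RiemannHypothesis → ∀ x : ℝ, 1 ≤ x → ψ x - θ x ≤ Real.sqrt x + 4 / 3 * x ^ ((1 : ℝ) / 3)) :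
    Nicolas2012_logf_lower_sharp := by
  intro hRH x hx
  have hx1 : (1 : ℝ) < x := by linarith
  obtain ⟨C, hC⟩ := NicolasJExplicit.exists_abs_Rone_le_of_RH hRH
  have hR : ∀ t, x ≤ t → |NicolasJ.Rone t| ≤ C * t ^ (3 / 2 : ℝ) := fun t ht ↦ hC t (by linarith)
  have hψθ : ∀ t, x ≤ t → ψ t - θ t ≤ Real.sqrt t + 4 / 3 * t ^ ((1 : ℝ) / 3) :=
    fun t ht ↦ h24 hRH t (by linarith)
  have h21 := NicolasK.lemma21_lower (by linarith : (121 : ℝ) ≤ x)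
    (Nicolas2012Sharp.theta_ge_four_fifths hS hRH hx)
  have h213 := NicolasK.cor21_upper hx1 hR hψθ
  have hJ := NicolasJExplicit.nicolasJ_ge_of_RH hRH hx1
  have hF2 := NicolasFz.Fhalf_le hx1
  have hF3 := NicolasFz.Fthird_le hx1
  have hS2 := Nicolas2012Sharp.sq_theta_sub_div_le hS hRH hx
  obtain ⟨a₁, ha₁⟩ : ∃ a : ℝ, a = 1 / (Real.sqrt x * Real.log x) := ⟨_, rfl⟩
  obtain ⟨a₂, ha₂⟩ : ∃ a : ℝ, a = 1 / (Real.sqrt x * Real.log x ^ 2) := ⟨_, rfl⟩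
  obtain ⟨a₃, ha₃⟩ : ∃ a : ℝ, a = 1 / (Real.sqrt x * Real.log x ^ 3) := ⟨_, rfl⟩
  obtain ⟨a₅, ha₅⟩ : ∃ a : ℝ, a = 1 / (x ^ ((2 : ℝ) / 3) * Real.log x) := ⟨_, rfl⟩
  have eJ : -nicolasBeta / (Real.sqrt x * Real.log x)
      - nicolasBeta * ((1 + 4 / Real.log x) / (Real.sqrt x * Real.log x ^ 2))
      - Real.log (2 * π) / (x * Real.log x) =
      -nicolasBeta * a₁ - nicolasBeta * a₂ - 4 * nicolasBeta * a₃ - Real.log (2 * π) / (x * Real.log x) := by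
    rw [ha₁, ha₂, ha₃]; ring
  have eF2 : 2 / (Real.sqrt x * Real.log x) - 2 / (Real.sqrt x * Real.log x ^ 2) +
      8 / (Real.sqrt x * Real.log x ^ 3) = 2 * a₁ - 2 * a₂ + 8 * a₃ := by
    rw [ha₁, ha₂, ha₃]; ring
  have eF3 : 3 / (2 * x ^ (2 / 3 : ℝ) * Real.log x) = 3 / 2 * a₅ := by
    rw [ha₅]; ring
  have eT : -(nicolasBeta + 2) / (√x * Real.log x) + (2 - nicolasBeta) / (√x * Real.log x ^ 2)
      - (8 + 4 * nicolasBeta) / (√x * Real.log x ^ 3) - Real.log (2 * π) / (x * Real.log x)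
      - 2 / (x ^ ((2 : ℝ) / 3) * Real.log x) - Real.log x ^ 3 / (64 * π ^ 2 * x) =
      -(nicolasBeta + 2) * a₁ + (2 - nicolasBeta) * a₂ - (8 + 4 * nicolasBeta) * a₃
      - Real.log (2 * π) / (x * Real.log x) - 2 * a₅ - Real.log x ^ 3 / (64 * π ^ 2 * x) := by
    rw [ha₁, ha₂, ha₃, ha₅]; ring
  rw [eT]
  rw [eJ] at hJ
  rw [eF2] at hF2
  rw [eF3] at hF3
  linarith

/-- **Nicolas 2012, (2.18) from Schoenfeld's `θ`-bound and Platt–Trudgian only** (the Case-1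
computation being proved). [cite: Nicolas2012, (2.18) (proof of Prop. 2.1)] -/
theorem Nicolas2012_logf_lower_sharp_of' (hS : Schoenfeld1976_theta) (hPT : PlattTrudgian2016_theta_lt) :
    Nicolas2012_logf_lower_sharp :=
  Nicolas2012_logf_lower_sharp_of_lemma24 hS fun hRH _ hx ↦ Nicolas2012_lemma24_upper_of hRH hS hPT hx

/-- **Lagarias's criterion** (Lagarias 2002, Thm. 1.1) from Schoenfeld's `θ`-bound, Platt–Trudgian's
`θ(x) < x`, and Robin's inequality along the colossally abundant chain below `4¹¹`.
[cite: Lagarias2002, Thm. 1.1] -/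
theorem lagarias_iff_of_schoenfeld_plattTrudgian (hS : Schoenfeld1976_theta) (hPT : PlattTrudgian2016_theta_lt)
    (hnum : RiemannHypothesis → robinCA_below (4 ^ 11)) : lagarias_iff :=
  lagarias_iff_of_Robin1984_sigma_le (Robin1984_sigma_le_of_thm1
    (Robin1984_thm1_of_sharp (Nicolas2012_logf_lower_sharp_of' hS hPT) hS hnum))

/-- **Lagarias's criterion, Briggs variant**: the same with Briggs's published computation.
[cite: Lagarias2002, Thm. 1.1] -/
theorem lagarias_iff_of_schoenfeld_plattTrudgian_briggs (hS : Schoenfeld1976_theta)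
    (hPT : PlattTrudgian2016_theta_lt) (hB : Briggs2006_robinInequality_le) : lagarias_iff :=
  lagarias_iff_of_three_facts_sharp (Nicolas2012_logf_lower_sharp_of' hS hPT) hS hB

/-- **Robin's criterion** (Robin 1984) from Schoenfeld's `θ`-bound, Platt–Trudgian and
`robinCA_below (4^11)`; the `Ω`-half is the proved `Nicolas1983_logf_omega_holds`.
[cite: Robin1984, Thm. 1 and §4 Prop. 1] -/
theorem robin_iff_of_schoenfeld_plattTrudgian (hS : Schoenfeld1976_theta) (hPT : PlattTrudgian2016_theta_lt)
    (hnum : robinCA_below (4 ^ 11)) : robin_iff :=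
  robin_iff_of_sharp_numeric (Nicolas2012_logf_lower_sharp_of' hS hPT) hS hnum Nicolas1983_logf_omega_holds

end Literature.NumberTheory.LFunctions

end
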